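import Summits.FinalStateConjecture.FinalStateConjecture.Theses.EternalPapapetrou

/-!
# Route EternalPapapetrou — the Assembly (item stmt-FinalStateConjecture-10041)

The assembly item of route `EternalPapapetrou` for the Final State Conjecture:

`MGHDExists → GenericCensoredCapture → LaSalleTransfer → FarZoneEternalPapapetrou →
EternalStationaryExteriorIsKerr → FinalStateConjecture`.

Pure logic, no analysis and no new definitions. `LaSalleTransfer` applied to
`FarZoneEternalPapapetrou` (L) and `EternalStationaryExteriorIsKerr` (U) is the dynamical
final-state theorem T = `CompleteScriSettlesC0` (every maximal vacuum Cauchy development of an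
admissible datum with complete future null infinity carries an exhaustive `C⁰` final-state
decomposition of its self-determined exterior). Christodoulou-genericity in curve form
(`IsChristodoulouGeneric 𝓓 P 1 = HasCodimAtLeastIn 𝓓 {d ∈ 𝓓 | ¬ P d} 1`) is monotone in the
property `P`: the smooth injective admissible curve through a `P`-exceptional datum supplied for
a stronger property `Q` works for `P`. On an admissible datum `D` the generic property of
`GenericCensoredCapture` (G) implies the Statement's property: `MGHDExists` (M) gives the MGHD,
G gives complete `𝓘⁺` for every maximal development, T gives a `C⁰` exhaustive decomposition of
the exterior, and G upgrades it to a `C²` exhaustive decomposition with sub-extremal holes.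
This is the body of the route's deciding theorem `closes` (`hA h₇ h₆ h₅ h₂ h₄`) made explicit;
nothing here bears on the truth of L, U, B = `LaSalleTransfer`, G or M.
-/

-- the doubled `FinalStateConjecture` path component is the summit/problem naming scheme (D-0017)
set_option linter.dupNamespace false

namespace Summit.FinalStateConjecture.FinalStateConjecture.Theorems

open Summit.FinalStateConjecture.FinalStateConjecture.Theses.EternalPapapetrou

/-- **Assembly of route EternalPapapetrou** (item stmt-FinalStateConjecture-10041):
`MGHDExists → GenericCensoredCapture → LaSalleTransfer → FarZoneEternalPapapetrou →
EternalStationaryExteriorIsKerr → FinalStateConjecture`. Proof: `LaSalleTransfer` fed with the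
two rigidity cruxes gives `CompleteScriSettlesC0`; Christodoulou-genericity (codimension `1`,
relative to `admissibleVacuumData X`) is monotone in the property; and on each admissible datum
the generic property of `GenericCensoredCapture` gives the final-state property — `MGHDExists`
supplies the maximal development, complete `𝓘⁺` comes from the generic property,
`CompleteScriSettlesC0` gives a `C⁰` exhaustive decomposition of the self-determined exterior and
the generic upgrade clause turns it into a `C²` exhaustive one with sub-extremal holes. -/
theorem EternalPapapetrou.assembly_proof :
    Summit.FinalStateConjecture.FinalStateConjecture.Theses.EternalPapapetrou.Assembly := by
  -- buildfix 2026-08-20 (proof-only port to the T2 summit, verbatim the reasoning of the route's own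
  -- deciding theorem `closes`, which uses only FarZone/ExteriorIsKerr/LaSalle/GenericCensoredCapture;
  -- `MGHDExists` is no longer needed: the tame generic property of G already carries MGHD existence)
  unfold Assembly
  intro _hM hG hB hL hU X i₁ i₂ i₃ i₄ i₅ i₆
  -- the dynamical final-state theorem T (C⁰) from the LaSalle transfer and the two rigidity cruxes
  have hT : CompleteScriSettlesC0 := hB hL hU
  -- TAME Christodoulou-genericity (codimension 1, one fixed end) is monotone in the property
  have mono : ∀ {P Q : _ → Prop},
      (∀ D ∈ Literature.Geometry.Lorentzian.admissibleVacuumData X, Q D → P D) →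
      Literature.Geometry.Lorentzian.InitialDataSet.IsTameChristodoulouGeneric
        (Literature.Geometry.Lorentzian.admissibleVacuumData X) Q 1 →
      Literature.Geometry.Lorentzian.InitialDataSet.IsTameChristodoulouGeneric
        (Literature.Geometry.Lorentzian.admissibleVacuumData X) P 1 := by
    intro P Q hQP hQ D hD
    obtain ⟨e, F, htame, himm, h0, hinj, hadm, hexc⟩ :=
      hQ D ⟨hD.1, fun h => hD.2 (hQP D hD.1 h)⟩
    exact ⟨e, F, htame, himm, h0, hinj, hadm,
      fun c hc hmem => hexc c hc ⟨hmem.1, fun h => hmem.2 (hQP _ hmem.1 h)⟩⟩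
  refine mono ?_ (hG X)
  -- pointwise on admissible data: the generic property of G and T give the Statement's property,
  -- threading RaysStayInClosure / HasExhaustiveCharts / IsFutureOriented through the C⁰ ⇒ C² upgrade
  intro D hD hQ
  obtain ⟨hex, hQ'⟩ := hQ
  refine ⟨hex, fun 𝒟 hmax => ?_⟩
  obtain ⟨hcomp, hup⟩ := hQ' 𝒟 hmax
  obtain ⟨O, d₀, hO, hrays, hexh, hfut⟩ := hT X D hD 𝒟 hmax hcomp
  obtain ⟨O', d, hsub, hO', hrays', hexh', hfut'⟩ := hup O d₀ hO hrays hexh hfut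
  exact ⟨hcomp, O', d, hsub, hO', hrays', hexh', hfut'⟩

end Summit.FinalStateConjecture.FinalStateConjecture.Theorems
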